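import Summits.QuantumFields.BalabanUV.T4Continuum.Support.GradedLineMassCommutatorScale
import Summits.QuantumFields.BalabanUV.T4Continuum.Support.GradedWellConsistencyTransfer

/-!
# T⁴ programme, spine node NE2 (U1a), sub-row Δ1 — THE GRADED WELL, leaf (GW-E), summand (E4), PART 2d: THE TWO-LEVEL COMMUTATOR OF THE
# GRADED MASS `M_GW = Q_GWᴴQ_GW`, `‖M_GW(k+1)·J_k − J_k·M_GW(k)‖ ≤ 3(m+1)L^{3m}·L^{−k}`, and the `hMc` slot of the graded-well END

Cell `pub-balaban-gaps` (YM blitz, track G2, seat ne2 = spine estimate NE2), continuing the parked NE2 formalisation lineage on its own plan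
(leaf-10-g7 STATUS «FILE C», `t4/T4-EST-NE2-D1-GW-SPEC.md` v1.1 §5: the END of record `GradedWellSandwichLaw.towerLimitRate_GW_of_GWB` holds
modulo `hco` ✓, `hE` ✓, **`hMc` = (E4)** and `hB` = (GW-B)).  Files A (`GradedLineAveragingTwoLevel`, p338648) and B (`GradedLineMassCommutatorScale`:
the per-scale, per-row-weight commutator `opNorm_JK_massComm_scale_le`) are the inputs.  THIS FILE:
 * §1 the `st`-row weight `stW`/`Pst` of a layer (print's «interface contours belong to the coarser side», the predicate cutting `RowV` out of
   `Σ_i (Anc s_i × Fin d)`), `‖P_st‖ ≤ 1`, and **`MGW_eq_sum : M_GW = Σ_{i ≤ m} w_i²·Q_{s_i}ᴴ·P_st(i)·Q_{s_i}`** (the subtype sum over `RowV` as a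
   filtered sigma sum);
 * §2 level `k+1` with level-`k` row indices: the row bijection `liftR` (file A's `liftAV` + the cast `s_i(k+1) = L·s_i(k)`), `avgS_liftR` /
   `avgS_submatrix_liftR` (the level-`k+1` averaging row IS file B's lifted row `avgSL`), `stW_liftR` (the `st`-weight is level-free:
   `blockOf ∘ cpt = blockOf`, `cpt` commutes with the contour shift — `GradedWellTwoLevel.cpt_shiftAnc`), hence **`layer_succ_eq`** and `wGW_succ_sq`
   (`w_i(k+1)² = L^d·w_i(k)²`);
 * §3 **`opNorm_MGW_comm_le (hk : m ≤ k) : ‖MGW (k+1)·JpcT k − JpcT k·MGW k‖ ≤ CMGW L m·(L⁻¹)^k`**, `CMGW L m = 3(m+1)L^{3m}` (layer `i` costs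
   `3w_i²s_i^{−d}s_i⁻¹ = 3L^{3i}L^{−k}`);
 * §4 **`hMc_GW`**: the 𝒢-sandwiched form `≤ Cst²·CMGW·(L⁻¹)^k` — the `hMc` binder of `GradedWellConsistencyTransfer.towerLimitRate_GW_of_laws` /
   `GradedWellSandwichLaw.towerLimitRate_GW_of_GWB` BY NAME — and `hMc_GW_of_le` (any `θ ≥ L⁻¹`).

HONEST FRAMING (T4-DAG p. 1).  [folklore] finite-sum bookkeeping over landed modules at MODEL level (`U = 1`, one layer map on unit blocks, `m`
fixed, finite torus, operator norm); statements and constants OURS; nothing of Bałaban's certified or disputed; NE2 (U1a) NOT proved; spine PROVED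
0/9 unchanged; NOT [B9] (3.16)/(3.23)–(3.27)/(3.42) as printed; NOT continuum YM, NOT infinite volume / mass gap / Clay.  HONEST DEPENDENCY: continuum
YM on T⁴ ⇐ BetaPertH ∧ nine spine estimates (0/9 proved); BetaPertH ⇐ (D1) ∧ (D4) ∧ CAP+tail; G-an2-4 gates asym, D1 and NE2/3/4.  No `sorry`,
no `def … : Prop`.
-/

noncomputable section

open scoped BigOperators ComplexConjugate Matrix Matrix.Norms.L2Operator
open Finset

namespace Summit.QuantumFields.BalabanUV.T4Continuum.GradedWellMassCommutator

open Literature.MathematicalPhysics.QuantumFieldTheory.Balaban1983to89.B5Prop11Plancherel (Tor fine Cst Cst_nonneg)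
open Literature.MathematicalPhysics.QuantumFieldTheory.Balaban1983to89.B5Prop11Lower (nsq nsq_nonneg)
open Literature.MathematicalPhysics.QuantumFieldTheory.Balaban1983to89.B5Blocks16 (blockOf)
open Literature.MathematicalPhysics.QuantumFieldTheory.Balaban1983to89.B5G183RateTorus (cpt)
open Literature.MathematicalPhysics.QuantumFieldTheory.Balaban1983to89.B5G183RateUnitTower (lev lev_neZero)
open Summit.QuantumFields.BalabanUV.T4Continuum
open Summit.QuantumFields.BalabanUV.T4Continuum.KingPairingPlantedLaw (JK JpcT JpcT_eq_JK calDalev)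
open Summit.QuantumFields.BalabanUV.T4Continuum.BalabanAveragedTowerUnit (idx)
open Summit.QuantumFields.BalabanUV.T4Continuum.GradedSubBlocks (Anchor Anc avgS shiftAnc)
open Summit.QuantumFields.BalabanUV.T4Continuum.GradedWellData
open Summit.QuantumFields.BalabanUV.T4Continuum.GradedWellSlice (sGW_dvd_lev)
open Summit.QuantumFields.BalabanUV.T4Continuum.GradedWellTwoLevel (sGW_succ anchor_lift cpt_shiftAnc blockOf_cpt_lev)
open Summit.QuantumFields.BalabanUV.T4Continuum.GradedLineAveragingTwoLevel (liftA liftAV)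
open Summit.QuantumFields.BalabanUV.T4Continuum.GradedLineMassCommutatorScale (avgSL opNorm_JK_massComm_scale_le)
open Summit.QuantumFields.BalabanUV.T4Continuum.GradedWellConsistencyTransfer (MGW opNorm_calDalev_sandwich_le)

variable {d : ℕ} (L : ℕ) [NeZero L] (M : Fin d → ℕ) [hM : ∀ μ, NeZero (M μ)] (k m : ℕ) (layer : Tor M → ℕ)

/-! ## §1 Print's `st`-row weight of a layer and the layer decomposition of the graded mass -/

/-- print's `st`-WEIGHT of layer `i` on the scale-`s_i` vector rows `(z, μ)` at level `k`: `1` if the contour `[z, z + s_i e_μ]` belongs to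
layer `i` — `min (layer of z's block) (layer of the block of z + s_i e_μ) = i`, the predicate cutting `RowV` out of `Σ_i (Anc s_i × Fin d)` — else `0`.
[cite: Balaban1984PropagatorsII, (2.3) p.224 (shape: «st(x)»)] [folklore] -/
def stW (i : Fin (m + 1)) (q : Anc (fine (lev L k) M) (sGW L k i) × Fin d) : ℂ :=
  if min (layer (blockOf (lev L k) M q.1.1))
      (layer (blockOf (lev L k) M (shiftAnc (fine (lev L k) M) (sGW L k i) (sGW_dvd L M k i) q.2 q.1).1)) = (i : ℕ) then 1 else 0

/-- **THE `st`-ROW WEIGHT OF LAYER `i`** as a diagonal 0/1 matrix on the scale-`s_i` vector rows. [folklore] -/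
def Pst (i : Fin (m + 1)) :
    Matrix (Anc (fine (lev L k) M) (sGW L k i) × Fin d) (Anc (fine (lev L k) M) (sGW L k i) × Fin d) ℂ :=
  Matrix.diagonal (stW L M k m layer i)

/-- `‖stW q‖ ≤ 1`. [folklore] -/
theorem norm_stW_le (i : Fin (m + 1)) (q : Anc (fine (lev L k) M) (sGW L k i) × Fin d) : ‖stW L M k m layer i q‖ ≤ 1 := by
  unfold stW; split_ifs <;> simp

/-- `‖P_st‖ ≤ 1`. [folklore] -/
theorem opNorm_Pst_le (i : Fin (m + 1)) : ‖Pst L M k m layer i‖ ≤ 1 := by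
  refine ScalarAveragedPropagator.opNorm_le_of_nsq_le_rect _ zero_le_one fun x => ?_
  rw [one_pow, one_mul]
  unfold nsq Pst
  refine Finset.sum_le_sum fun q _ => ?_
  rw [Matrix.mulVec_diagonal, norm_mul]
  exact pow_le_pow_left₀ (mul_nonneg (norm_nonneg _) (norm_nonneg _))
    (mul_le_of_le_one_left (norm_nonneg _) (norm_stW_le L M k m layer i q)) 2

/-- **THE LAYER DECOMPOSITION OF THE GRADED MASS**: `M_GW = Q_GWᴴQ_GW = Σ_{i ≤ m} w_i² · Q_{s_i}ᴴ·P_st(i)·Q_{s_i}`.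
[cite: Balaban1985BackgroundPropagators, (3.16) p.393 (shape: the layer sum)] [folklore] -/
theorem MGW_eq_sum : MGW L M k m layer
    = ∑ i : Fin (m + 1), (((wGW L k d i) ^ 2 : ℝ) : ℂ) •
        ((avgS (fine (lev L k) M) (sGW L k i))ᴴ * Pst L M k m layer i * avgS (fine (lev L k) M) (sGW L k i)) := by
  ext b b'
  unfold MGW
  rw [Matrix.mul_apply, Matrix.sum_apply]
  -- the subtype sum over `RowV` as a filtered sum over the sigma type
  have hsub : ∑ p : RowV L M k m layer, (QvGW L M k m layer)ᴴ b p * QvGW L M k m layer p b'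
      = ∑ x ∈ (univ : Finset ((i : Fin (m + 1)) × (Anc (fine (lev L k) M) (sGW L k i) × Fin d))).filter
          (fun x => min (layer (blockOf (lev L k) M x.2.1.1))
            (layer (blockOf (lev L k) M (shiftAnc (fine (lev L k) M) (sGW L k x.1) (sGW_dvd L M k x.1) x.2.2 x.2.1).1)) = (x.1 : ℕ)),
          star ((((wGW L k d x.1 : ℝ)) : ℂ) * avgS (fine (lev L k) M) (sGW L k x.1) x.2 b)
            * ((((wGW L k d x.1 : ℝ)) : ℂ) * avgS (fine (lev L k) M) (sGW L k x.1) x.2 b') := by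
    rw [Finset.sum_subtype (((univ : Finset ((i : Fin (m + 1)) × (Anc (fine (lev L k) M) (sGW L k i) × Fin d))).filter
          (fun x => min (layer (blockOf (lev L k) M x.2.1.1))
            (layer (blockOf (lev L k) M (shiftAnc (fine (lev L k) M) (sGW L k x.1) (sGW_dvd L M k x.1) x.2.2 x.2.1).1))
              = (x.1 : ℕ)))) (p := fun x => min (layer (blockOf (lev L k) M x.2.1.1))
            (layer (blockOf (lev L k) M (shiftAnc (fine (lev L k) M) (sGW L k x.1) (sGW_dvd L M k x.1) x.2.2 x.2.1).1))
              = (x.1 : ℕ)) (by intro x; simp)]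
    rfl
  rw [hsub, Finset.sum_filter, Fintype.sum_sigma]
  refine Finset.sum_congr rfl fun i _ => ?_
  rw [Matrix.smul_apply, smul_eq_mul, Matrix.mul_apply, Finset.mul_sum]
  refine Finset.sum_congr rfl fun q _ => ?_
  dsimp only
  unfold Pst
  rw [Matrix.mul_diagonal, Matrix.conjTranspose_apply]
  unfold stW
  split_ifs with h
  · simp only [star_mul', Complex.star_def, Complex.conj_ofReal, mul_one]
    push_cast
    ring
  · simp

/-! ## §2 Level `k+1` with level-`k` row indices: the row bijection and the lifted layer -/

variable {k m} in
omit [NeZero L] hM in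
/-- `i ≤ k` for a layer index `i ≤ m ≤ k`. [folklore] -/
theorem fin_le (hk : m ≤ k) (i : Fin (m + 1)) : (i : ℕ) ≤ k := le_trans (Nat.le_of_lt_succ i.isLt) hk

/-- **THE ROW BIJECTION OF LAYER `i`**: scale-`s_i(k)` vector rows of level `k` ≃ scale-`s_i(k+1)` vector rows of level `k+1`, `(z, μ) ↦ (cpt z, μ)`
(file A's `liftAV` followed by the cast `L·s_i(k) = s_i(k+1)`). [folklore] -/
def liftR (hk : m ≤ k) (i : Fin (m + 1)) :
    Anc (fine (lev L k) M) (sGW L k i) × Fin d ≃ Anc (fine (lev L (k + 1)) M) (sGW L (k + 1) i) × Fin d :=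
  (liftAV (lev L k) L M (sGW L k i)).trans
    ((Equiv.subtypeEquivRight (fun x => by rw [sGW_succ L k (fin_le hk i)]; exact Iff.rfl)).prodCongr (Equiv.refl (Fin d)))

/-- the lifted row's anchor is `cpt z`. [folklore] -/
theorem liftR_fst_val (hk : m ≤ k) (i : Fin (m + 1)) (q : Anc (fine (lev L k) M) (sGW L k i) × Fin d) :
    ((liftR L M k m hk i) q).1.1 = cpt (lev L k) L M q.1.1 := rfl

/-- the lifted row's direction is unchanged. [folklore] -/
theorem liftR_snd (hk : m ≤ k) (i : Fin (m + 1)) (q : Anc (fine (lev L k) M) (sGW L k i) × Fin d) :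
    ((liftR L M k m hk i) q).2 = q.2 := rfl

omit hM in
/-- averaging entries do not see which (propositionally equal) scale names the anchor type. [folklore] -/
theorem avgS_congr_scale {N : Fin d → ℕ} [∀ ν, NeZero (N ν)] {s s' : ℕ} [NeZero s] [NeZero s'] (h : s = s')
    (x : Tor N) (hx : Anchor N s x) (hx' : Anchor N s' x) (μ : Fin d) (b : Tor N × Fin d) :
    avgS N s (⟨x, hx⟩, μ) b = avgS N s' (⟨x, hx'⟩, μ) b := by
  subst h; rfl

/-- **the level-`k+1` averaging row of layer `i` IS file B's lifted row**: `Q_{s_i(k+1)}(liftR q) = (Q_{L·s_i} ∘ liftAV)(q)`. [folklore] -/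
theorem avgS_liftR (hk : m ≤ k) (i : Fin (m + 1)) (q : Anc (fine (lev L k) M) (sGW L k i) × Fin d)
    (b : TorK L M (k + 1) × Fin d) :
    avgS (fine (lev L (k + 1)) M) (sGW L (k + 1) i) ((liftR L M k m hk i) q) b = avgSL (lev L k) L M (sGW L k i) q b := by
  show avgS (fine (lev L (k + 1)) M) (sGW L (k + 1) i) (⟨cpt (lev L k) L M q.1.1, _⟩, q.2) b
    = avgS (fine (L * lev L k) M) (L * sGW L k i) (⟨cpt (lev L k) L M q.1.1, _⟩, q.2) b
  exact avgS_congr_scale (sGW_succ L k (fin_le hk i)) _ _ _ _ _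

/-- `Q_{s_i(k+1)} ∘ liftR = Q_{L·s_i} ∘ liftAV` as matrices. [folklore] -/
theorem avgS_submatrix_liftR (hk : m ≤ k) (i : Fin (m + 1)) :
    (avgS (fine (lev L (k + 1)) M) (sGW L (k + 1) i)).submatrix (liftR L M k m hk i) id = avgSL (lev L k) L M (sGW L k i) := by
  ext q b
  exact avgS_liftR L M k m hk i q b

/-- **the `st`-weight is level-free along the lift** (`blockOf ∘ cpt = blockOf`, `cpt` commutes with the contour shift). [folklore] -/
theorem stW_liftR (hk : m ≤ k) (i : Fin (m + 1)) (q : Anc (fine (lev L k) M) (sGW L k i) × Fin d) :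
    stW L M (k + 1) m layer i ((liftR L M k m hk i) q) = stW L M k m layer i q := by
  have e2 : (shiftAnc (fine (lev L (k + 1)) M) (sGW L (k + 1) i) (sGW_dvd L M (k + 1) i) q.2 ((liftR L M k m hk i) q).1).1
      = cpt (lev L k) L M (shiftAnc (fine (lev L k) M) (sGW L k i) (sGW_dvd L M k i) q.2 q.1).1 :=
    cpt_shiftAnc L M k (fin_le hk i) q.2 q.1
  unfold stW
  rw [liftR_snd, e2, liftR_fst_val, blockOf_cpt_lev, blockOf_cpt_lev]

/-- `P_st^{(k+1)}(i) ∘ (liftR × liftR) = P_st^{(k)}(i)`. [folklore] -/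
theorem Pst_submatrix_liftR (hk : m ≤ k) (i : Fin (m + 1)) :
    (Pst L M (k + 1) m layer i).submatrix (liftR L M k m hk i) (liftR L M k m hk i) = Pst L M k m layer i := by
  unfold Pst
  rw [Matrix.submatrix_diagonal_equiv]
  congr 1
  funext q
  exact stW_liftR L M k m layer hk i q

omit hM in
/-- reindexing the inner (row) index of a sandwich `Xᴴ·D·X` by an equivalence changes nothing. [folklore] -/
theorem reindex_sandwich {ι ι' τ : Type*} [Fintype ι] [Fintype ι'] [DecidableEq ι] [DecidableEq ι'] (e : ι ≃ ι')
    (X : Matrix ι' τ ℂ) (D : Matrix ι' ι' ℂ) :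
    (X.submatrix e id)ᴴ * D.submatrix e e * X.submatrix e id = Xᴴ * D * X := by
  rw [Matrix.conjTranspose_submatrix, Matrix.submatrix_mul_equiv, Matrix.submatrix_mul_equiv, Matrix.submatrix_id_id]

/-- **THE LAYER-`i` MASS OF LEVEL `k+1` IN FILE B's SPELLING**: `Q_{s_i(k+1)}ᴴ·P_st^{(k+1)}(i)·Q_{s_i(k+1)} = (Q_{L·s_i}∘lift)ᴴ·P_st^{(k)}(i)·(Q_{L·s_i}∘lift)`
(reindex the inner row index by `liftR`; the `st`-weight is level-free). [folklore] -/
theorem layer_succ_eq (hk : m ≤ k) (i : Fin (m + 1)) :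
    (avgS (fine (lev L (k + 1)) M) (sGW L (k + 1) i))ᴴ * Pst L M (k + 1) m layer i * avgS (fine (lev L (k + 1)) M) (sGW L (k + 1) i)
      = ((avgSL (lev L k) L M (sGW L k i) : Matrix (Anc (fine (lev L k) M) (sGW L k i) × Fin d) (TorK L M (k + 1) × Fin d) ℂ))ᴴ
          * Pst L M k m layer i
          * (avgSL (lev L k) L M (sGW L k i) : Matrix (Anc (fine (lev L k) M) (sGW L k i) × Fin d) (TorK L M (k + 1) × Fin d) ℂ) := by
  rw [← reindex_sandwich (liftR L M k m hk i), avgS_submatrix_liftR L M k m hk i, Pst_submatrix_liftR L M k m layer hk i]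
  rfl

omit [NeZero L] hM in
/-- the weights: `w_i(k+1)² = L^d·w_i(k)²` (`i ≤ k`). [folklore] -/
theorem wGW_succ_sq (hk : m ≤ k) (i : Fin (m + 1)) : wGW L (k + 1) d i ^ 2 = (L : ℝ) ^ d * wGW L k d i ^ 2 := by
  rw [wGW_sq, wGW_sq, sGW_succ L k (fin_le hk i), Nat.cast_mul, mul_pow]
  ring

/-! ## §3 (E4): the two-level commutator of the graded mass -/

/-- the constant of (E4): `C_M = 3(m+1)L^{3m}` (depends on `L, m` only). [folklore] -/
def CMGW (L m : ℕ) : ℝ := 3 * (m + 1) * (L : ℝ) ^ (3 * m)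

omit [NeZero L] hM in
/-- `0 ≤ C_M`. [folklore] -/
theorem CMGW_nonneg : 0 ≤ CMGW L m := by unfold CMGW; positivity

omit hM in
/-- the per-layer rate: `3·w_i²·s_i^{−d}·s_i⁻¹ ≤ 3·L^{3m}·L^{−k}` (`w_i² = L^{2i}s_i^d`, `s_i = L^{k−i}`, `i ≤ m ≤ k`). [folklore] -/
theorem layer_rate_le (hk : m ≤ k) (i : Fin (m + 1)) :
    3 * wGW L k d i ^ 2 * ((((sGW L k i : ℕ) : ℝ)) ^ d)⁻¹ * (((sGW L k i : ℕ) : ℝ))⁻¹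
      ≤ 3 * (L : ℝ) ^ (3 * m) * ((L : ℝ)⁻¹) ^ k := by
  have hi := fin_le hk i
  have hL : (0 : ℝ) < L := by exact_mod_cast Nat.pos_of_ne_zero (NeZero.ne L)
  have hL1 : (1 : ℝ) ≤ L := by exact_mod_cast Nat.one_le_iff_ne_zero.mpr (NeZero.ne L)
  have hs : (((sGW L k i : ℕ) : ℝ)) = (L : ℝ) ^ (k - i) := by
    show (((lev L (k - i) : ℕ)) : ℝ) = _
    rw [lev_eq_pow, Nat.cast_pow]
  rw [wGW_sq, hs]
  have hsd : (0 : ℝ) < ((L : ℝ) ^ (k - i)) ^ d := by positivity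
  have e1 : 3 * ((L : ℝ) ^ (2 * (i : ℕ)) * ((L : ℝ) ^ (k - i)) ^ d) * (((L : ℝ) ^ (k - i)) ^ d)⁻¹ * ((L : ℝ) ^ (k - i))⁻¹
      = 3 * (L : ℝ) ^ (3 * (i : ℕ)) * ((L : ℝ)⁻¹) ^ k := by
    have hk' : (L : ℝ) ^ k = (L : ℝ) ^ (k - i) * (L : ℝ) ^ (i : ℕ) := by rw [← pow_add, Nat.sub_add_cancel hi]
    have hL0 : (L : ℝ) ≠ 0 := hL.ne'
    rw [inv_pow, hk']
    field_simp
    ring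
  rw [e1]
  have hpow : (L : ℝ) ^ (3 * (i : ℕ)) ≤ (L : ℝ) ^ (3 * m) :=
    pow_le_pow_right₀ hL1 (Nat.mul_le_mul_left 3 (Nat.le_of_lt_succ i.isLt))
  exact mul_le_mul_of_nonneg_right (by linarith) (by positivity)

/-- **(E4) — THE TWO-LEVEL COMMUTATOR OF THE GRADED MASS** (`m ≤ k`): `‖M_GW(k+1)·J_k − J_k·M_GW(k)‖ ≤ C_M·L^{−k}`,
`C_M = 3(m+1)L^{3m}` — layer by layer file B's `opNorm_JK_massComm_scale_le` (E3's cancellation at scale `s_i`, weight `κ = w_i²`,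
row weight `P_st(i)`), the level-`k+1` layer being the lifted one (`layer_succ_eq`, `wGW_succ_sq`). [folklore] -/
theorem opNorm_MGW_comm_le (hk : m ≤ k) :
    ‖MGW L M (k + 1) m layer * JpcT L M k - JpcT L M k * MGW L M k m layer‖ ≤ CMGW L m * ((L : ℝ)⁻¹) ^ k := by
  rw [MGW_eq_sum L M (k + 1) m layer, MGW_eq_sum L M k m layer, Matrix.sum_mul, Matrix.mul_sum, ← Finset.sum_sub_distrib]
  refine (norm_sum_le _ _).trans ?_
  have per : ∀ i ∈ (univ : Finset (Fin (m + 1))),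
      ‖(((wGW L (k + 1) d i) ^ 2 : ℝ) : ℂ) •
          ((avgS (fine (lev L (k + 1)) M) (sGW L (k + 1) i))ᴴ * Pst L M (k + 1) m layer i
            * avgS (fine (lev L (k + 1)) M) (sGW L (k + 1) i)) * JpcT L M k
        - JpcT L M k * ((((wGW L k d i) ^ 2 : ℝ) : ℂ) •
          ((avgS (fine (lev L k) M) (sGW L k i))ᴴ * Pst L M k m layer i * avgS (fine (lev L k) M) (sGW L k i)))‖
        ≤ 3 * (L : ℝ) ^ (3 * m) * ((L : ℝ)⁻¹) ^ k := by
    intro i _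
    rw [layer_succ_eq L M k m layer hk i, wGW_succ_sq L k m hk i, norm_sub_rev, JpcT_eq_JK]
    exact (opNorm_JK_massComm_scale_le (lev L k) L M (sGW L k i) (sGW_dvd_lev L k i) (Pst L M k m layer i)
      (opNorm_Pst_le L M k m layer i) (wGW L k d i ^ 2) (sq_nonneg _)).trans (layer_rate_le L k m hk i)
  refine (Finset.sum_le_sum per).trans (le_of_eq ?_)
  rw [Finset.sum_const, Finset.card_univ, Fintype.card_fin, nsmul_eq_mul]
  unfold CMGW
  push_cast
  ring

/-! ## §4 The `hMc` slot of the graded-well END -/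

variable (a : ℝ) (ha : 0 < a)

/-- **THE 𝒢-SANDWICHED GRADED-MASS LAW** (`m ≤ k`): `‖𝒢^{(k+1)}·(M_GW(k+1)J_k − J_kM_GW(k))·𝒢^{(k)}‖ ≤ Cst²·C_M·L^{−k}` — the `hMc` binder of
`GradedWellConsistencyTransfer.towerLimitRate_GW_of_laws` / `GradedWellSandwichLaw.towerLimitRate_GW_of_GWB` BY NAME at `θ = L⁻¹`.
[cite: Balaban1984PropagatorsI, Prop. 1.1 (1.89) p.33 (shape: the sandwich `Cst²`)] [folklore] -/
theorem hMc_GW (k : ℕ) (hk : m ≤ k) :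
    ‖(calDalev L M a ha (k + 1))⁻¹ * (MGW L M (k + 1) m layer * JpcT L M k - JpcT L M k * MGW L M k m layer)
        * (calDalev L M a ha k)⁻¹‖ ≤ Cst d a ^ 2 * CMGW L m * ((L : ℝ)⁻¹) ^ k := by
  rw [mul_assoc (Cst d a ^ 2)]
  exact (opNorm_calDalev_sandwich_le L M k a ha _).trans
    (mul_le_mul_of_nonneg_left (opNorm_MGW_comm_le L M k m layer hk) (sq_nonneg _))

/-- the same at any rate `θ ≥ L⁻¹` (the END's display `CM·θ^k`). [folklore] -/
theorem hMc_GW_of_le {θ : ℝ} (hθ : (L : ℝ)⁻¹ ≤ θ) (k : ℕ) (hk : m ≤ k) :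
    ‖(calDalev L M a ha (k + 1))⁻¹ * (MGW L M (k + 1) m layer * JpcT L M k - JpcT L M k * MGW L M k m layer)
        * (calDalev L M a ha k)⁻¹‖ ≤ Cst d a ^ 2 * CMGW L m * θ ^ k :=
  (hMc_GW L M m layer a ha k hk).trans (mul_le_mul_of_nonneg_left
    (pow_le_pow_left₀ (inv_nonneg.mpr (Nat.cast_nonneg L)) hθ k) (mul_nonneg (sq_nonneg _) (CMGW_nonneg L m)))

end Summit.QuantumFields.BalabanUV.T4Continuum.GradedWellMassCommutator

end
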